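import Literature.Topology.FourManifolds.CollarReparamPullback
import Literature.Topology.FourManifolds.BoundaryGluingConstruction
import HarnessLib

/-!
# The reparametrised collars as isometries: pullback formulas along `inPt`

Support file (everything proved, no definitions, no named facts) for the τ-equivariant collar
gluing (stub `stub_collarGluing` of crux `CorkRegluablePsc`, item stmt-SmoothPoincare4-3206),
continuing `CollarReparamPullback.lean`.  For the long open collar `D` of a closed collar `c`
(`D.toFun x t = c (x, tanh t)`, `BoundaryData.Collar.exists_openCollar_tanh`) the gluing maps of
the three-piece gluing `M ∪_φ N` (`BoundaryGluingConstruction.lean`) are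
`p ↦ D.inPt p : ∂M × (0, ∞) → M - ∂M` and `p ↦ D_N.inPt (φ p₁, -p₂) : ∂M × (-∞, 0) → N - ∂N`.
If a field of bilinear forms `G` on `TM` pulls back under `c` to the warped form
`ε² V₂ V'₂ + F(x, s) h_x(V₁, V'₁)` (Bär–Hanke 2023, §3, Def. 21), then along these maps it pulls
back to `ε² (1 - tanh² t)² v₂ w₂ + F(·, tanh (±t)) h(·)(…)` (`val_mfderiv_inPt_eq`,
`val_mfderiv_inPt_neg_eq`): the chain rule of `pullbackBilin_collar_reparam` at points where the
maps are honest smooth maps of the open sets `{±t > 0}`.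

## References

* B. O'Neill, *Semi-Riemannian Geometry* (1983), Ch. 3, Def. 3.9, p. 58. [ONeill1983]
* C. Bär, B. Hanke, *Boundary conditions for scalar curvature* (2023), §3, Def. 21. [BarHanke2023]
-/

noncomputable section

open scoped Manifold ContDiff Topology
open Set Function Filter

namespace Literature.Topology.FourManifolds

open Literature.Geometry.Lorentzian

universe u

variable {n : ℕ} {M : Type u} [TopologicalSpace M] [ChartedSpace (EuclideanHalfSpace (n + 1)) M]
  {b : BoundaryData (𝓡∂ (n + 1)) M (𝓡 n)}
  {E' : Type*} [NormedAddCommGroup E'] [NormedSpace ℝ E'] {H' : Type*} [TopologicalSpace H']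
  {I' : ModelWithCorners ℝ E' H'} {N : Type*} [TopologicalSpace N] [ChartedSpace H' N]

/-- **The reparametrised collar pulls the warped form back along `q ↦ D.inPt (ψ q₁, ρ q₂)`.**
Let `D` be the long open collar of the closed collar `c` (`D x t = c (x, tanh t)`), `G` a field of
bilinear forms on `TM` with `(c^* G)_{(x,s)}(V, V') = ε² V₂ V'₂ + F(x, s) h_x(V₁, V'₁)`, `ψ`
differentiable at `q₁` and `σ` differentiable at `q₂` with derivative `σ'` and `σ q₂ > 0`.  Then,
with `ρ = tanh ∘ σ`, the map `Φ q = (D.inPt (ψ q₁, σ q₂)).val` satisfies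
`G_{Φ q}(dΦ v, dΦ w) = ε² ((1 - tanh² (σ q₂)) σ')² v₂ w₂ + F(ψ q₁, tanh (σ q₂)) h_{ψ q₁}(dψ v₁, dψ w₁)`.
[cite: ONeill1983, Ch. 3, Def. 3.9 and p. 58] -/
theorem val_mfderiv_inPt_comp_eq (c : b.Collar) (D : b.OpenCollar)
    (hD : ∀ x t, D.toFun x t = c (x, Set.projIcc (0 : ℝ) 1 zero_le_one (Real.tanh t)))
    (G : Π x : M, TangentSpace (𝓡∂ (n + 1)) x →L[ℝ] TangentSpace (𝓡∂ (n + 1)) x →L[ℝ] ℝ)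
    (h : Π x : b.carrier, TangentSpace (𝓡 n) x →L[ℝ] TangentSpace (𝓡 n) x →L[ℝ] ℝ)
    (F : b.carrier × Set.Icc (0 : ℝ) 1 → ℝ) (ε : ℝ)
    (hc : ∀ (p : b.carrier × Set.Icc (0 : ℝ) 1) (V V' : TangentSpace ((𝓡 n).prod (𝓡∂ 1)) p),
      pullbackBilin (I := 𝓡∂ (n + 1)) (I' := (𝓡 n).prod (𝓡∂ 1)) c G p V V' =
        ε ^ 2 * ((show EuclideanSpace ℝ (Fin 1) from V.2) 0 *
          (show EuclideanSpace ℝ (Fin 1) from V'.2) 0) + F p * h p.1 V.1 V'.1)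
    {ψ : N → b.carrier} {σ : ℝ → ℝ} {σ' : ℝ} {q : N × ℝ}
    (hψ : MDifferentiableAt I' (𝓡 n) ψ q.1) (hσ : HasDerivAt σ σ' q.2) (hσq : 0 < σ q.2)
    (v w : TangentSpace (I'.prod 𝓘(ℝ, ℝ)) q) :
    G (D.inPt (ψ q.1, σ q.2)).val
        (mfderiv (I'.prod 𝓘(ℝ, ℝ)) (𝓡∂ (n + 1)) (fun q : N × ℝ ↦ (D.inPt (ψ q.1, σ q.2)).val) q v)
        (mfderiv (I'.prod 𝓘(ℝ, ℝ)) (𝓡∂ (n + 1)) (fun q : N × ℝ ↦ (D.inPt (ψ q.1, σ q.2)).val) q w) =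
      ε ^ 2 * ((1 - Real.tanh (σ q.2) ^ 2) * σ') ^ 2 * (v.2 * w.2) +
        F (ψ q.1, Set.projIcc (0 : ℝ) 1 zero_le_one (Real.tanh (σ q.2))) *
          h (ψ q.1) (mfderiv I' (𝓡 n) ψ q.1 v.1) (mfderiv I' (𝓡 n) ψ q.1 w.1) := by
  -- near `q` the map is the reparametrised collar `q ↦ c (ψ q₁, tanh (σ q₂))`
  have hev : ∀ᶠ q' in 𝓝 q, 0 < σ q'.2 :=
    (hσ.continuousAt.comp continuousAt_snd).preimage_mem_nhds (isOpen_Ioi.mem_nhds hσq)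
  have hfun : (fun q : N × ℝ ↦ (D.inPt (ψ q.1, σ q.2)).val) =ᶠ[𝓝 q]
      fun q : N × ℝ ↦ c (ψ q.1, Set.projIcc (0 : ℝ) 1 zero_le_one
        ((fun t ↦ Real.tanh (σ t)) q.2)) := by
    filter_upwards [hev] with q' hq'
    rw [D.inPt_val (p := (ψ q'.1, σ q'.2)) hq', hD]
  have hbase : (D.inPt (ψ q.1, σ q.2)).val =
      c (ψ q.1, Set.projIcc (0 : ℝ) 1 zero_le_one (Real.tanh (σ q.2))) := by
    rw [D.inPt_val (p := (ψ q.1, σ q.2)) hσq, hD]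
  have hρ : HasDerivAt (fun t ↦ Real.tanh (σ t)) ((1 - Real.tanh (σ q.2) ^ 2) * σ') q.2 :=
    (hasDerivAt_real_tanh (σ q.2)).comp q.2 hσ
  have hρq : (fun t ↦ Real.tanh (σ t)) q.2 ∈ Ioo (0 : ℝ) 1 :=
    ⟨tanh_pos_iff.2 hσq, Real.tanh_lt_one _⟩
  have key := pullbackBilin_collar_reparam c G h F ε hc hψ hρ hρq v w
  rw [pullbackBilin_apply, ← hfun.mfderiv_eq] at key
  -- transport the base point
  have hgen : ∀ (x y : M), x = y → ∀ (v₀ w₀ : TangentSpace (𝓡∂ (n + 1)) x),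
      G x v₀ w₀ = G y v₀ w₀ := by
    rintro x _ rfl v₀ w₀
    rfl
  exact (hgen _ _ hbase _ _).trans key

/-- **The collar of `M` as an isometry** (first gluing map `p ↦ D.inPt p`, `t > 0`): with the
warped form `(c^* G) = ε² ds² + F h`, along `Φ p = (D.inPt p).val` one has
`G(dΦ v, dΦ w) = ε² (1 - tanh² t)² v₂ w₂ + F(z, tanh t) h_z(v₁, w₁)`.
[cite: ONeill1983, Ch. 3, Def. 3.9 and p. 58] -/
theorem val_mfderiv_inPt_eq (c : b.Collar) (D : b.OpenCollar)
    (hD : ∀ x t, D.toFun x t = c (x, Set.projIcc (0 : ℝ) 1 zero_le_one (Real.tanh t)))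
    (G : Π x : M, TangentSpace (𝓡∂ (n + 1)) x →L[ℝ] TangentSpace (𝓡∂ (n + 1)) x →L[ℝ] ℝ)
    (h : Π x : b.carrier, TangentSpace (𝓡 n) x →L[ℝ] TangentSpace (𝓡 n) x →L[ℝ] ℝ)
    (F : b.carrier × Set.Icc (0 : ℝ) 1 → ℝ) (ε : ℝ)
    (hc : ∀ (p : b.carrier × Set.Icc (0 : ℝ) 1) (V V' : TangentSpace ((𝓡 n).prod (𝓡∂ 1)) p),
      pullbackBilin (I := 𝓡∂ (n + 1)) (I' := (𝓡 n).prod (𝓡∂ 1)) c G p V V' =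
        ε ^ 2 * ((show EuclideanSpace ℝ (Fin 1) from V.2) 0 *
          (show EuclideanSpace ℝ (Fin 1) from V'.2) 0) + F p * h p.1 V.1 V'.1)
    {p : b.carrier × ℝ} (hp : 0 < p.2) (v w : TangentSpace ((𝓡 n).prod 𝓘(ℝ, ℝ)) p) :
    G (D.inPt p).val
        (mfderiv ((𝓡 n).prod 𝓘(ℝ, ℝ)) (𝓡∂ (n + 1)) (InteriorManifold.val ∘ D.inPt) p v)
        (mfderiv ((𝓡 n).prod 𝓘(ℝ, ℝ)) (𝓡∂ (n + 1)) (InteriorManifold.val ∘ D.inPt) p w) =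
      ε ^ 2 * (1 - Real.tanh p.2 ^ 2) ^ 2 * (v.2 * w.2) +
        F (p.1, Set.projIcc (0 : ℝ) 1 zero_le_one (Real.tanh p.2)) * h p.1 v.1 w.1 := by
  have key := val_mfderiv_inPt_comp_eq (I' := 𝓡 n) (N := b.carrier) c D hD G h F ε hc
    (ψ := id) (σ := id) (σ' := 1) (q := p) mdifferentiableAt_id (hasDerivAt_id p.2) hp v w
  have hfun : (fun q : b.carrier × ℝ ↦ (D.inPt (id q.1, id q.2)).val) =
      InteriorManifold.val ∘ D.inPt := rfl
  rw [hfun, mfderiv_id] at key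
  simp only [id_eq, mul_one] at key
  exact key

/-- **The re-indexed collar of `N` as an isometry** (second gluing map
`p ↦ D.inPt (φ p₁, -p₂)`, `t < 0`): with `(c^* G) = ε² ds² + F h` for the collar `c` of `N`,
along `Φ p = (D.inPt (φ p₁, -p₂)).val` one has
`G(dΦ v, dΦ w) = ε² (1 - tanh² t)² v₂ w₂ + F(φ z, tanh (-t)) h_{φ z}(dφ v₁, dφ w₁)`.
[cite: ONeill1983, Ch. 3, Def. 3.9 and p. 58] -/
theorem val_mfderiv_inPt_neg_eq (c : b.Collar) (D : b.OpenCollar)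
    (hD : ∀ x t, D.toFun x t = c (x, Set.projIcc (0 : ℝ) 1 zero_le_one (Real.tanh t)))
    (G : Π x : M, TangentSpace (𝓡∂ (n + 1)) x →L[ℝ] TangentSpace (𝓡∂ (n + 1)) x →L[ℝ] ℝ)
    (h : Π x : b.carrier, TangentSpace (𝓡 n) x →L[ℝ] TangentSpace (𝓡 n) x →L[ℝ] ℝ)
    (F : b.carrier × Set.Icc (0 : ℝ) 1 → ℝ) (ε : ℝ)
    (hc : ∀ (p : b.carrier × Set.Icc (0 : ℝ) 1) (V V' : TangentSpace ((𝓡 n).prod (𝓡∂ 1)) p),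
      pullbackBilin (I := 𝓡∂ (n + 1)) (I' := (𝓡 n).prod (𝓡∂ 1)) c G p V V' =
        ε ^ 2 * ((show EuclideanSpace ℝ (Fin 1) from V.2) 0 *
          (show EuclideanSpace ℝ (Fin 1) from V'.2) 0) + F p * h p.1 V.1 V'.1)
    {φ : N → b.carrier} {p : N × ℝ} (hφ : MDifferentiableAt I' (𝓡 n) φ p.1) (hp : p.2 < 0)
    (v w : TangentSpace (I'.prod 𝓘(ℝ, ℝ)) p) :
    G (D.inPt (φ p.1, -p.2)).val
        (mfderiv (I'.prod 𝓘(ℝ, ℝ)) (𝓡∂ (n + 1)) (fun q : N × ℝ ↦ (D.inPt (φ q.1, -q.2)).val) p v)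
        (mfderiv (I'.prod 𝓘(ℝ, ℝ)) (𝓡∂ (n + 1)) (fun q : N × ℝ ↦ (D.inPt (φ q.1, -q.2)).val) p w) =
      ε ^ 2 * (1 - Real.tanh p.2 ^ 2) ^ 2 * (v.2 * w.2) +
        F (φ p.1, Set.projIcc (0 : ℝ) 1 zero_le_one (Real.tanh (-p.2))) *
          h (φ p.1) (mfderiv I' (𝓡 n) φ p.1 v.1) (mfderiv I' (𝓡 n) φ p.1 w.1) := by
  have key := val_mfderiv_inPt_comp_eq c D hD G h F ε hc (ψ := φ) (σ := fun t ↦ -t)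
    (σ' := -1) (q := p) hφ (hasDerivAt_neg p.2) (by simpa using hp) v w
  rw [key, Real.tanh_neg]
  ring

end Literature.Topology.FourManifolds
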